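import Mathlib
import HarnessLib
import Summits.Langlands.Statement
import Summits.Langlands.Langlands.Theses.AnchoredInductionCarving
import Summits.Langlands.Langlands.Theses.InsolubleInductionCarving
import Summits.Langlands.Langlands.Theses.WeilRestrictionSplit
import Summits.Langlands.Langlands.Theorems.PolarisationCarvingBoxes
import Literature.NumberTheory.GaloisRepresentations.GaloisRep
import Literature.NumberTheory.GaloisRepresentations.AbsGaloisGroup
import Literature.NumberTheory.GaloisRepresentations.ContinuousRep
import Literature.NumberTheory.GaloisRepresentations.InducedGaloisRep
import Literature.NumberTheory.GaloisRepresentations.LabelledHodgeTateWeights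
import Literature.NumberTheory.GaloisRepresentations.ToLocalRestrictField
import Literature.NumberTheory.PAdicHodge.FontaineDpst
import Literature.FieldTheory.AlgClosed.PadicAlgClEquivComplex
import Literature.Barriers.Langlands.TaylorWilesNumericalCoincidence

set_option linter.dupNamespace false

/-! # InsolubleInduction — statement-and-kernel support module (tree twin, PART 1 of 2, of the decomp-langlands lens-6 gen-16 node
`InsolubleInductionCarving`; `--supports stmt-Langlands-27748`)

The node (HOME/nodes/lens-6-g16-InsolubleInductionCarving.lean, sha256 ade835391d19…, 702 lines, CLEARED crit-1 row 188) lives in the ROUTE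
namespace `…Theses.InsolubleInductionCarving`; the child route was born as `Summits/Langlands/Langlands/Theses/InsolubleInductionCarving.lean`
(route-Langlands-InsolubleInductionCarving rev 0 @e71840856f39; items IFD 28043 · NIU 28044 · RIA 28045 · FRAME″ 28046 · Assembly 28047), so this
twin lives under `…Theorems.InsolubleInduction` (critic advisory e3 / RUNME §3b) and imports the born route: every cell def below is tied to the
route decl BY NAME with an `Iff.rfl` bridge (§3c).  Texts of §1–§5 are the node's VERBATIM (header abridged; see the node for §0 «the carving in
one paragraph», §0b «why lens 6», §0c REPAIR CENSUS).  PART 2 (`Theorems/InsolubleInductionKernel.lean`) carries the node's `Cert` section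
(necessity, `ria_of_regularCells`, reachability lemmas, `barrier_certificate`, `dri_witness_not_solvableGalois`, TR/CM halves).

TARGET: UNR = `AnchoredInductionCarving.UnreachableDeepAutomorphy` (stmt-Langlands-27748).  DIAL DRI(ρ) «ρ induces HT-regularly to a TR/CM
subfield F₀ ⊆ K» (plain induction DOWN, solvability-free).  CUT: UNR ⟺ DIU ∧ NIU (`unr_iff_cells`, one excluded middle), DIU ⟸ RIA ∧ IFD
(`diu_of_ria_ifd`), `closes (hRIA hIFD hNIU hF) : _root_.Langlands`.
-/

namespace Summit.Langlands.Langlands.Theorems.InsolubleInduction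


open scoped NumberField Classical Polynomial Matrix
open Filter IsDedekindDomain Polynomial
open Literature.NumberTheory.Automorphic Literature.NumberTheory.GaloisRepresentations
open Literature.NumberTheory.PAdicHodge
open Summit.Langlands.Langlands.Theses
open Summit.Langlands.Langlands.Theorems.PolarisationCarvingBoxes (HasSelfTwist IsPinnedGeometric PrimitiveAutomorphyWhere
  IsOfTRCMType htAt IsHTRegular IsOfPolarisedType InUnpolarisedBox HasWeightString InGappedBox IsPotentiallyOrdinary IsOfSystemType
  InAnordinarySystemBox pol_iff_box unp_iff_box cw_iff_box gwo_iff_box gns_iff_box gnl_iff_box)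

/-! ## §1  Vocabulary of the host box (VERBATIM lens-6 g11/g14/g15; node-local, over the landed support module `Theorems/PolarisationCarvingBoxes`) -/

/-- `SandwichOfType Q ρ` (g11 verbatim). -/
def SandwichOfType
    (Q : ∀ (K₀ : Type) [Field K₀] [NumberField K₀] (ℓ : ℕ) [Fact ℓ.Prime] (n : ℕ),
      FramedGaloisRep K₀ (PadicAlgCl ℓ) n → Prop)
    {K : Type} [Field K] [NumberField K] {ℓ : ℕ} [Fact ℓ.Prime] {n : ℕ}
    (ρ : FramedGaloisRep K (PadicAlgCl ℓ) n) : Prop :=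
  ∃ (L : Type) (_ : Field L) (_ : NumberField L) (_ : Algebra K L),
    IsGalois K L ∧ IsSolvable (L ≃ₐ[K] L) ∧
    ∃ (K₀ : Type) (_ : Field K₀) (_ : NumberField K₀) (_ : Algebra K₀ L),
      IsGalois K₀ L ∧ IsSolvable (L ≃ₐ[K₀] L) ∧
      ∃ (ρ₀ : FramedGaloisRep K₀ (PadicAlgCl ℓ) n) (χ : FramedGaloisRep L (PadicAlgCl ℓ) 1),
        IsPinnedGeometric ρ₀ ∧ Q K₀ ℓ n ρ₀ ∧
        ∀ g : Field.absoluteGaloisGroup L,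
          FramedRep.trace (ρ.restrictField L) g = FramedRep.trace χ g * FramedRep.trace (ρ₀.restrictField L) g

/-- `IsOddEssSelfDual r` (g11 verbatim). -/
def IsOddEssSelfDual {F : Type} [Field F] [NumberField F] {ℓ : ℕ} [Fact ℓ.Prime] {m : ℕ}
    (r : FramedGaloisRep F (PadicAlgCl ℓ) m) : Prop :=
  ∃ (μ : FramedGaloisRep F (PadicAlgCl ℓ) 1) (A : Matrix (Fin m) (Fin m) (PadicAlgCl ℓ)), IsUnit A.det ∧
    (∀ σ : Field.absoluteGaloisGroup F, (r σ).val.transpose * A * (r σ).val = FramedRep.trace μ σ • A) ∧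
    ∀ (φ : F →+* ℝ) (c : Field.absoluteGaloisGroup F), IsComplexConjugation φ c →
      A.transpose = FramedRep.trace μ c • A

/-- Base clause IRP of PolarisationCarving's IRT cell (g11 verbatim). -/
def InducesToRegularPolarised {K₀ : Type} [Field K₀] [NumberField K₀] {ℓ : ℕ} [Fact ℓ.Prime] {n : ℕ}
    (ρ₀ : FramedGaloisRep K₀ (PadicAlgCl ℓ) n) : Prop :=
  ∃ (F₀ : Type) (_ : Field F₀) (_ : NumberField F₀) (_ : Algebra F₀ K₀) (_ : FiniteDimensional F₀ K₀)
    (hF : Module.finrank F₀ K₀ = 2),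
    NumberField.IsTotallyReal F₀ ∧ IsOddEssSelfDual (ρ₀.induce F₀ hF) ∧ IsHTRegular (ρ₀.induce F₀ hF)

/-- Base clause IAS of PolarisationCarving's AST cell (g11 verbatim). -/
def InducesToAbelianSurfaceType {K₀ : Type} [Field K₀] [NumberField K₀] {ℓ : ℕ} [Fact ℓ.Prime] {n : ℕ}
    (ρ₀ : FramedGaloisRep K₀ (PadicAlgCl ℓ) n) : Prop :=
  n = 2 ∧
    (∃ (F₀ : Type) (_ : Field F₀) (_ : NumberField F₀) (_ : Algebra F₀ K₀) (_ : FiniteDimensional F₀ K₀)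
      (hF : Module.finrank F₀ K₀ = 2),
      NumberField.IsTotallyReal F₀ ∧ IsOddEssSelfDual (ρ₀.induce F₀ hF)) ∧
    ∀ (v : HeightOneSpectrum (𝓞 K₀)) (hv : ((ℓ : ℕ) : 𝓞 K₀) ∈ v.asIdeal) (τ : v.adicCompletion K₀ →+* PadicAlgCl ℓ),
      Continuous τ → htAt ρ₀ v hv τ = {0, 1}

/-- `IsOfInducedRegularType ρ` (g11 verbatim). -/
def IsOfInducedRegularType {K : Type} [Field K] [NumberField K] {ℓ : ℕ} [Fact ℓ.Prime] {n : ℕ}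
    (ρ : FramedGaloisRep K (PadicAlgCl ℓ) n) : Prop :=
  SandwichOfType (fun K₀ _ _ ℓ _ n ρ₀ => InducesToRegularPolarised (K₀ := K₀) (ℓ := ℓ) (n := n) ρ₀) ρ

/-- `IsOfAbelianSurfaceType ρ` (g11 verbatim). -/
def IsOfAbelianSurfaceType {K : Type} [Field K] [NumberField K] {ℓ : ℕ} [Fact ℓ.Prime] {n : ℕ}
    (ρ : FramedGaloisRep K (PadicAlgCl ℓ) n) : Prop :=
  SandwichOfType (fun K₀ _ _ ℓ _ n ρ₀ => InducesToAbelianSurfaceType (K₀ := K₀) (ℓ := ℓ) (n := n) ρ₀) ρ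

/-- `InDeepBox ρ` (g14 verbatim) — not of TR/CM type, not of induced-regular type, not of abelian-surface type. -/
def InDeepBox {K : Type} [Field K] [NumberField K] {ℓ : ℕ} [Fact ℓ.Prime] {n : ℕ}
    (ρ : FramedGaloisRep K (PadicAlgCl ℓ) n) : Prop :=
  ¬ IsOfTRCMType (K := K) (ℓ := ℓ) (n := n) ρ ∧
    (¬ IsOfInducedRegularType (K := K) (ℓ := ℓ) (n := n) ρ ∧ ¬ IsOfAbelianSurfaceType (K := K) (ℓ := ℓ) (n := n) ρ)

/-- `HasFiniteProjectiveImage ρ` (g14 verbatim). -/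
def HasFiniteProjectiveImage {K : Type} [Field K] [NumberField K] {ℓ : ℕ} [Fact ℓ.Prime] {n : ℕ}
    (ρ : FramedGaloisRep K (PadicAlgCl ℓ) n) : Prop :=
  ∃ (L : Type) (_ : Field L) (_ : NumberField L) (_ : Algebra K L),
    ∀ σ : Field.absoluteGaloisGroup L, ∃ c : PadicAlgCl ℓ,
      ((ρ.restrictField L σ : GL (Fin n) (PadicAlgCl ℓ)) : Matrix (Fin n) (Fin n) (PadicAlgCl ℓ)) =
        c • (1 : Matrix (Fin n) (Fin n) (PadicAlgCl ℓ))

/-- `SolvablyReachable K` (g15 verbatim): K ⊆ L, L solvable Galois over some K₀, K₀ solvable Galois over some TR/CM F₀. -/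
def SolvablyReachable (K : Type) [Field K] [NumberField K] : Prop :=
  ∃ (L : Type) (_ : Field L) (_ : NumberField L) (_ : Algebra K L) (K₀ : Type) (_ : Field K₀) (_ : NumberField K₀) (_ : Algebra K₀ L),
    IsGalois K₀ L ∧ IsSolvable (L ≃ₐ[K₀] L) ∧
    ∃ (F₀ : Type) (_ : Field F₀) (_ : NumberField F₀) (_ : Algebra F₀ K₀), IsGalois F₀ K₀ ∧ IsSolvable (K₀ ≃ₐ[F₀] K₀) ∧
      (NumberField.IsTotallyReal F₀ ∨ NumberField.IsCMField F₀)

/-- **UNR's box** (the target's hypothesis on (K, ρ)): deep, infinite projective image, K unreachable. -/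
def UnrBox {K : Type} [Field K] [NumberField K] {ℓ : ℕ} [Fact ℓ.Prime] {n : ℕ}
    (ρ : FramedGaloisRep K (PadicAlgCl ℓ) n) : Prop :=
  (InDeepBox (K := K) (ℓ := ℓ) (n := n) ρ ∧ ¬ HasFiniteProjectiveImage (K := K) (ℓ := ℓ) (n := n) ρ) ∧ ¬ SolvablyReachable K

/-- Weak automorphy of σ over F (the conclusion clause of every cell of the ladder; g8 grammar): an L-algebraic cuspidal π on GL_m/F whose
Satake parameters match σ's Frobenius characteristic polynomials at almost all places. -/
def WeaklyAutomorphic {F : Type} [Field F] [NumberField F] {ℓ : ℕ} [Fact ℓ.Prime] (ι : PadicAlgCl ℓ ≃+* ℂ) {m : ℕ}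
    (hcpt : isCompact_glFiniteIntegralLevel m F) (σ : FramedGaloisRep F (PadicAlgCl ℓ) m) : Prop :=
  ∃ π : CuspidalAutomorphicRepData m F hcpt, π.1.IsLAlgebraic ∧
    ∀ᶠ w : HeightOneSpectrum (𝓞 F) in cofinite, SatakeFrobCompatibleAt ι π.1 σ w

/-- **The target IS the tree's**: UNR (tree decl, born text, never re-typed) ↔ weak automorphy on `UnrBox`, by `Iff.rfl`. -/
theorem unr_iff_box :
    AnchoredInductionCarving.UnreachableDeepAutomorphy ↔
      PrimitiveAutomorphyWhere fun K _ _ ℓ _ n ρ => UnrBox (K := K) (ℓ := ℓ) (n := n) ρ :=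
  Iff.rfl

/-! ## §2  THE DIAL — direct regular inducibility to a TR/CM SUBFIELD (solvability-free, sandwich-free) — and the avatar vocabulary -/

/-- **DRI(ρ)**: some totally real or CM subfield F₀ ⊆ K of finite index d (K/F₀ arbitrary: not assumed Galois, not assumed solvable) such
that the induced representation `ρ.induce F₀ hd : Γ_{F₀} → GL_{d n}` is Hodge–Tate regular over F₀. -/
def InducesRegularlyToSubfield {K : Type} [Field K] [NumberField K] {ℓ : ℕ} [Fact ℓ.Prime] {n : ℕ}
    (ρ : FramedGaloisRep K (PadicAlgCl ℓ) n) : Prop :=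
  ∃ (F₀ : Type) (_ : Field F₀) (_ : NumberField F₀) (_ : Algebra F₀ K) (_ : FiniteDimensional F₀ K) (d : ℕ)
    (hd : Module.finrank F₀ K = d),
    (NumberField.IsTotallyReal F₀ ∨ NumberField.IsCMField F₀) ∧ IsHTRegular (ρ.induce F₀ hd)

/-- `IsTraceSummand σ R` — σ is a trace summand («constituent») of R: tr R = tr σ + tr ω for some framed ω (possibly of rank 0). -/
def IsTraceSummand {F : Type} [Field F] {ℓ : ℕ} [Fact ℓ.Prime] {m N : ℕ}
    (σ : FramedGaloisRep F (PadicAlgCl ℓ) m) (R : FramedGaloisRep F (PadicAlgCl ℓ) N) : Prop :=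
  ∃ (k : ℕ) (ω : FramedGaloisRep F (PadicAlgCl ℓ) k),
    ∀ g : Field.absoluteGaloisGroup F, FramedRep.trace R g = FramedRep.trace σ g + FramedRep.trace ω g

/-- **The avatar block** `AvatarAutomorphy ι ρ`: for every TR/CM subfield F₀ ⊆ K with `ρ.induce F₀ hd` HT-regular, every irreducible,
pinned-geometric, twist-primitive, HT-regular trace summand σ of rank m ≥ 2 of the induction is weakly automorphic over F₀. -/
def AvatarAutomorphy {K : Type} [Field K] [NumberField K] {ℓ : ℕ} [Fact ℓ.Prime] (ι : PadicAlgCl ℓ ≃+* ℂ) {n : ℕ}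
    (ρ : FramedGaloisRep K (PadicAlgCl ℓ) n) : Prop :=
  ∀ (F₀ : Type) [Field F₀] [NumberField F₀] [Algebra F₀ K] [FiniteDimensional F₀ K] (d : ℕ) (hd : Module.finrank F₀ K = d),
    (NumberField.IsTotallyReal F₀ ∨ NumberField.IsCMField F₀) → IsHTRegular (ρ.induce F₀ hd) →
    ∀ (m : ℕ) (hcpt₀ : isCompact_glFiniteIntegralLevel m F₀), 2 ≤ m →
      ∀ (σ : FramedGaloisRep F₀ (PadicAlgCl ℓ) m), σ.toGaloisRep.IsIrreducible → IsPinnedGeometric σ → ¬ HasSelfTwist σ →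
        IsHTRegular σ → IsTraceSummand σ (ρ.induce F₀ hd) → WeaklyAutomorphic ι hcpt₀ σ

/-- Cells with a custom conclusion `C` on UNR-style boxes (node-local combinator): `PrimitiveAutomorphyWhere P` is the case
`C = WeaklyAutomorphic` (`primitiveAutomorphyWhere_eq`). -/
def PrimitiveWhere
    (P : ∀ (K : Type) [Field K] [NumberField K] (ℓ : ℕ) [Fact ℓ.Prime] (n : ℕ), FramedGaloisRep K (PadicAlgCl ℓ) n → Prop)
    (C : ∀ (K : Type) [Field K] [NumberField K] (ℓ : ℕ) [Fact ℓ.Prime] (n : ℕ),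
      (PadicAlgCl ℓ ≃+* ℂ) → isCompact_glFiniteIntegralLevel n K → FramedGaloisRep K (PadicAlgCl ℓ) n → Prop) : Prop :=
  ∀ (K : Type) [Field K] [NumberField K] (n : ℕ) (hcpt : isCompact_glFiniteIntegralLevel n K), 2 ≤ n →
    ∀ (ℓ : ℕ) [Fact ℓ.Prime] (ι : PadicAlgCl ℓ ≃+* ℂ) (ρ : FramedGaloisRep K (PadicAlgCl ℓ) n),
      ρ.toGaloisRep.IsIrreducible → IsPinnedGeometric ρ → ¬ HasSelfTwist ρ → P K ℓ n ρ → C K ℓ n ι hcpt ρ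

/-- the node-local `PrimitiveWhere` agrees with the landed `PolarisationCarvingBoxes.PrimitiveAutomorphyWhere` (same text). -/
theorem primitiveAutomorphyWhere_eq
    (P : ∀ (K : Type) [Field K] [NumberField K] (ℓ : ℕ) [Fact ℓ.Prime] (n : ℕ), FramedGaloisRep K (PadicAlgCl ℓ) n → Prop) :
    PrimitiveAutomorphyWhere P = PrimitiveWhere P (fun K _ _ ℓ _ n ι hcpt ρ => WeaklyAutomorphic (F := K) (ℓ := ℓ) ι (m := n) hcpt ρ) :=
  rfl

/-! ## §3  The pieces (INLINE one-line texts = UNR's tree text with ONE conjunct joined to the box clause, resp. the avatar block as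
conclusion / extra hypothesis; < 10.8 k chars each; generated by `gen16.py` from the tree line, bridged to the structured forms by `Iff.rfl`) -/

/-- DIU — the ATTACKED cell (node-only, NOT filed: it is split functionally as RIA ∧ IFD): UNR's box ∧ DRI. -/
def DirectlyInducedUnreachableAutomorphy : Prop :=
  PrimitiveAutomorphyWhere fun K _ _ ℓ _ n ρ =>
    UnrBox (K := K) (ℓ := ℓ) (n := n) ρ ∧ InducesRegularlyToSubfield (K := K) (ℓ := ℓ) (n := n) ρ

/-- crux (rank 3) · NIU — NOT DIRECTLY REGULARLY INDUCIBLE (DECLARED RESIDUAL; BARRIER Shimura ∧ TW(α) ∧ NonRegularWeight ∧ SolvableImage).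
UNR's text VERBATIM with the conjunct ¬DRI joined to its box clause. -/
def NonInducedUnreachableAutomorphy : Prop :=
  ∀ (K : Type) [Field K] [NumberField K] (n : ℕ) (hcpt : Literature.NumberTheory.Automorphic.isCompact_glFiniteIntegralLevel n K), 2 ≤ n → ∀ (ℓ : ℕ) [Fact ℓ.Prime] (ι : PadicAlgCl ℓ ≃+* ℂ) (ρ : Literature.NumberTheory.GaloisRepresentations.FramedGaloisRep K (PadicAlgCl ℓ) n), ρ.toGaloisRep.IsIrreducible → ((∀ᶠ v : IsDedekindDomain.HeightOneSpectrum (NumberField.RingOfIntegers K) in Filter.cofinite, ρ.IsUnramifiedAt v) ∧ ∀ (v : IsDedekindDomain.HeightOneSpectrum (NumberField.RingOfIntegers K)) (hv : ((ℓ : ℕ) : NumberField.RingOfIntegers K) ∈ v.asIdeal), (Literature.NumberTheory.PAdicHodge.fontainePstAdicCompletion v ℓ hv).IsDeRhamFramed (ρ.toLocal v)) → ¬ (∃ η : Literature.NumberTheory.GaloisRepresentations.FramedGaloisRep K (PadicAlgCl ℓ) 1, (∃ᶠ v : IsDedekindDomain.HeightOneSpectrum (NumberField.RingOfIntegers K)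 in Filter.cofinite, ∃ a : PadicAlgCl ℓ, a ≠ 1 ∧ η.HasFrobCharpolyAt v (Polynomial.X - Polynomial.C a)) ∧ ∀ᶠ v : IsDedekindDomain.HeightOneSpectrum (NumberField.RingOfIntegers K) in Filter.cofinite, ∃ (P : Polynomial (PadicAlgCl ℓ)) (a : PadicAlgCl ℓ), ρ.HasFrobCharpolyAt v P ∧ η.HasFrobCharpolyAt v (Polynomial.X - Polynomial.C a) ∧ P.scaleRoots a = P) → ((((¬ (∃ (L : Type) (_ : Field L) (_ : NumberField L) (_ : Algebra K L), IsGalois K L ∧ IsSolvable (L ≃ₐ[K] L) ∧ ∃ (K₀ : Type) (_ : Field K₀) (_ : NumberField K₀) (_ : Algebra K₀ L), IsGalois K₀ L ∧ IsSolvable (L ≃ₐ[K₀] L) ∧ ∃ (ρ₀ : Literature.NumberTheory.GaloisRepresentations.FramedGaloisRep K₀ (PadicAlgCl ℓ) n) (χ : Literature.NumberTheory.GaloisRepresentations.FramedGaloisRep L (PadicAlgCl ℓ) 1), ((∀ᶠ v : IsDedekindDomain.HeightOneSpectrum (NumberField.RingOfIntegers K₀) in Filter.cofinite, ρ₀.IsUnramifiedAt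 v) ∧ ∀ (v : IsDedekindDomain.HeightOneSpectrum (NumberField.RingOfIntegers K₀)) (hv : ((ℓ : ℕ) : NumberField.RingOfIntegers K₀) ∈ v.asIdeal), (Literature.NumberTheory.PAdicHodge.fontainePstAdicCompletion v ℓ hv).IsDeRhamFramed (ρ₀.toLocal v)) ∧ (NumberField.IsTotallyReal K₀ ∨ NumberField.IsCMField K₀) ∧ ∀ g : Field.absoluteGaloisGroup L, Literature.NumberTheory.GaloisRepresentations.FramedRep.trace (ρ.restrictField L) g = Literature.NumberTheory.GaloisRepresentations.FramedRep.trace χ g * Literature.NumberTheory.GaloisRepresentations.FramedRep.trace (ρ₀.restrictField L) g) ∧ (¬ (∃ (L : Type) (_ : Field L) (_ : NumberField L) (_ : Algebra K L), IsGalois K L ∧ IsSolvable (L ≃ₐ[K] L) ∧ ∃ (K₀ : Type) (_ : Field K₀) (_ : NumberField K₀) (_ : Algebra K₀ L), IsGalois K₀ L ∧ IsSolvable (L ≃ₐ[K₀] L) ∧ ∃ (ρ₀ : Literature.NumberTheory.GaloisRepresentations.FramedGaloisRep K₀ (PadicAlgCl ℓ) n) (χ : Literature.NumberTheory.GaloisRepresentations.FramedGaloisRep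 L (PadicAlgCl ℓ) 1), ((∀ᶠ v : IsDedekindDomain.HeightOneSpectrum (NumberField.RingOfIntegers K₀) in Filter.cofinite, ρ₀.IsUnramifiedAt v) ∧ ∀ (v : IsDedekindDomain.HeightOneSpectrum (NumberField.RingOfIntegers K₀)) (hv : ((ℓ : ℕ) : NumberField.RingOfIntegers K₀) ∈ v.asIdeal), (Literature.NumberTheory.PAdicHodge.fontainePstAdicCompletion v ℓ hv).IsDeRhamFramed (ρ₀.toLocal v)) ∧ (∃ (F₀ : Type) (_ : Field F₀) (_ : NumberField F₀) (_ : Algebra F₀ K₀) (_ : FiniteDimensional F₀ K₀) (hF : Module.finrank F₀ K₀ = 2), NumberField.IsTotallyReal F₀ ∧ (∃ (μ : Literature.NumberTheory.GaloisRepresentations.FramedGaloisRep F₀ (PadicAlgCl ℓ) 1) (A : Matrix (Fin (2 * n)) (Fin (2 * n)) (PadicAlgCl ℓ)), IsUnit A.det ∧ (∀ σ : Field.absoluteGaloisGroup F₀, ((ρ₀.induce F₀ hF) σ).val.transpose * A * ((ρ₀.induce F₀ hF) σ).val = Literature.NumberTheory.GaloisRepresentations.FramedRep.trace μ σ • A)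 ∧ ∀ (φ : F₀ →+* ℝ) (c : Field.absoluteGaloisGroup F₀), Literature.NumberTheory.GaloisRepresentations.IsComplexConjugation φ c → A.transpose = Literature.NumberTheory.GaloisRepresentations.FramedRep.trace μ c • A) ∧ (∀ (v : IsDedekindDomain.HeightOneSpectrum (NumberField.RingOfIntegers F₀)) (hv : ((ℓ : ℕ) : NumberField.RingOfIntegers F₀) ∈ v.asIdeal) (τ : v.adicCompletion F₀ →+* PadicAlgCl ℓ), Continuous τ → ((ρ₀.induce F₀ hF).labelledHodgeTateWeightsAt v (Literature.NumberTheory.PAdicHodge.fontainePstAdicCompletion v ℓ hv).algebra (Literature.NumberTheory.PAdicHodge.fontainePstAdicCompletion v ℓ hv).𝔅 τ).Nodup)) ∧ ∀ g : Field.absoluteGaloisGroup L, Literature.NumberTheory.GaloisRepresentations.FramedRep.trace (ρ.restrictField L) g = Literature.NumberTheory.GaloisRepresentations.FramedRep.trace χ g * Literature.NumberTheory.GaloisRepresentations.FramedRep.trace (ρ₀.restrictField L) g) ∧ ¬ (∃ (L : Type) (_ : Field L) (_ : NumberField L) (_ : Algebra K L), IsGalois K L ∧ IsSolvable (L ≃ₐ[K]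 L) ∧ ∃ (K₀ : Type) (_ : Field K₀) (_ : NumberField K₀) (_ : Algebra K₀ L), IsGalois K₀ L ∧ IsSolvable (L ≃ₐ[K₀] L) ∧ ∃ (ρ₀ : Literature.NumberTheory.GaloisRepresentations.FramedGaloisRep K₀ (PadicAlgCl ℓ) n) (χ : Literature.NumberTheory.GaloisRepresentations.FramedGaloisRep L (PadicAlgCl ℓ) 1), ((∀ᶠ v : IsDedekindDomain.HeightOneSpectrum (NumberField.RingOfIntegers K₀) in Filter.cofinite, ρ₀.IsUnramifiedAt v) ∧ ∀ (v : IsDedekindDomain.HeightOneSpectrum (NumberField.RingOfIntegers K₀)) (hv : ((ℓ : ℕ) : NumberField.RingOfIntegers K₀) ∈ v.asIdeal), (Literature.NumberTheory.PAdicHodge.fontainePstAdicCompletion v ℓ hv).IsDeRhamFramed (ρ₀.toLocal v)) ∧ (n = 2 ∧ (∃ (F₀ : Type) (_ : Field F₀) (_ : NumberField F₀) (_ : Algebra F₀ K₀) (_ : FiniteDimensional F₀ K₀) (hF : Module.finrank F₀ K₀ = 2), NumberField.IsTotallyReal F₀ ∧ (∃ (μ : Literature.NumberTheory.GaloisRepresentations.FramedGaloisRep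 F₀ (PadicAlgCl ℓ) 1) (A : Matrix (Fin (2 * n)) (Fin (2 * n)) (PadicAlgCl ℓ)), IsUnit A.det ∧ (∀ σ : Field.absoluteGaloisGroup F₀, ((ρ₀.induce F₀ hF) σ).val.transpose * A * ((ρ₀.induce F₀ hF) σ).val = Literature.NumberTheory.GaloisRepresentations.FramedRep.trace μ σ • A) ∧ ∀ (φ : F₀ →+* ℝ) (c : Field.absoluteGaloisGroup F₀), Literature.NumberTheory.GaloisRepresentations.IsComplexConjugation φ c → A.transpose = Literature.NumberTheory.GaloisRepresentations.FramedRep.trace μ c • A)) ∧ ∀ (v : IsDedekindDomain.HeightOneSpectrum (NumberField.RingOfIntegers K₀)) (hv : ((ℓ : ℕ) : NumberField.RingOfIntegers K₀) ∈ v.asIdeal) (τ : v.adicCompletion K₀ →+* PadicAlgCl ℓ), Continuous τ → ρ₀.labelledHodgeTateWeightsAt v (Literature.NumberTheory.PAdicHodge.fontainePstAdicCompletion v ℓ hv).algebra (Literature.NumberTheory.PAdicHodge.fontainePstAdicCompletion v ℓ hv).𝔅 τ = {0, 1}) ∧ ∀ g : Field.absoluteGaloisGroup L, Literature.NumberTheory.GaloisRepresentations.FramedRep.trace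 (ρ.restrictField L) g = Literature.NumberTheory.GaloisRepresentations.FramedRep.trace χ g * Literature.NumberTheory.GaloisRepresentations.FramedRep.trace (ρ₀.restrictField L) g))) ∧ ¬ (∃ (L : Type) (_ : Field L) (_ : NumberField L) (_ : Algebra K L), ∀ σ : Field.absoluteGaloisGroup L, ∃ c : PadicAlgCl ℓ, ((ρ.restrictField L σ : GL (Fin n) (PadicAlgCl ℓ)) : Matrix (Fin n) (Fin n) (PadicAlgCl ℓ)) = c • (1 : Matrix (Fin n) (Fin n) (PadicAlgCl ℓ)))) ∧ ¬ (∃ (L : Type) (_ : Field L) (_ : NumberField L) (_ : Algebra K L) (K₀ : Type) (_ : Field K₀) (_ : NumberField K₀) (_ : Algebra K₀ L), IsGalois K₀ L ∧ IsSolvable (L ≃ₐ[K₀] L) ∧ ∃ (F₀ : Type) (_ : Field F₀) (_ : NumberField F₀) (_ : Algebra F₀ K₀), IsGalois F₀ K₀ ∧ IsSolvable (K₀ ≃ₐ[F₀] K₀) ∧ (NumberField.IsTotallyReal F₀ ∨ NumberField.IsCMField F₀))) ∧ ¬ (∃ (F₀ : Type) (_ : Field F₀) (_ : NumberField F₀)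 (_ : Algebra F₀ K) (_ : FiniteDimensional F₀ K) (d : ℕ) (hd : Module.finrank F₀ K = d), (NumberField.IsTotallyReal F₀ ∨ NumberField.IsCMField F₀) ∧ Summit.Langlands.Langlands.Theorems.PolarisationCarvingBoxes.IsHTRegular (ρ.induce F₀ hd))) → ∃ π : Literature.NumberTheory.Automorphic.CuspidalAutomorphicRepData n K hcpt, π.1.IsLAlgebraic ∧ ∀ᶠ v : IsDedekindDomain.HeightOneSpectrum (NumberField.RingOfIntegers K) in Filter.cofinite, SatakeFrobCompatibleAt ι π.1 ρ v

/-- support (rank 9) · RIA — REGULAR INSOLUBLE AVATARS ARE AUTOMORPHIC.  NOT STAFFED HERE: kernel-dominated BY NAME by the five REGULAR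
TR/CM cells of the host lineage's root carving `PolarisationCarving` (rev 6) — `RegularPolarisedAutomorphy` 33822 ∧ `ConsecutiveWeightAutomorphy`
33398 ∧ `GappedOrdinaryAutomorphy` 33399 ∧ `GappedNonOrdinarySystemAutomorphy` 33400 ∧ `GappedNonOrdinaryLoneAutomorphy` 33401 ⟹ RIA
(`Cert.ria_of_regularCells`; coarsely `PolarisedTypeAutomorphy` 32056 ∧ `UnpolarisedTRCMTypeAutomorphy` 32055 ⟹ RIA, `Cert.ria_of_trcmCells`):
the avatar σ is a regular irreducible pinned-geometric twist-primitive representation over a TR/CM field, i.e. a member of exactly those cells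
(engines there: BLGGT / ten-author lifting / Qian; their common missing input α = residual automorphy).  UNR's hypotheses VERBATIM ∧ DRI,
conclusion = the avatar block.  It closes when those host cells close; it is listed so that `closes` is self-contained over this route's items. -/
def RegularInsolubleAvatarAutomorphy : Prop :=
  ∀ (K : Type) [Field K] [NumberField K] (n : ℕ) (hcpt : Literature.NumberTheory.Automorphic.isCompact_glFiniteIntegralLevel n K), 2 ≤ n → ∀ (ℓ : ℕ) [Fact ℓ.Prime] (ι : PadicAlgCl ℓ ≃+* ℂ) (ρ : Literature.NumberTheory.GaloisRepresentations.FramedGaloisRep K (PadicAlgCl ℓ) n), ρ.toGaloisRep.IsIrreducible → ((∀ᶠ v : IsDedekindDomain.HeightOneSpectrum (NumberField.RingOfIntegers K) in Filter.cofinite, ρ.IsUnramifiedAt v) ∧ ∀ (v : IsDedekindDomain.HeightOneSpectrum (NumberField.RingOfIntegers K)) (hv : ((ℓ : ℕ) : NumberField.RingOfIntegers K) ∈ v.asIdeal), (Literature.NumberTheory.PAdicHodge.fontainePstAdicCompletion v ℓ hv).IsDeRhamFramed (ρ.toLocal v)) → ¬ (∃ η : Literature.NumberTheory.GaloisRepresentations.FramedGaloisRep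 K (PadicAlgCl ℓ) 1, (∃ᶠ v : IsDedekindDomain.HeightOneSpectrum (NumberField.RingOfIntegers K) in Filter.cofinite, ∃ a : PadicAlgCl ℓ, a ≠ 1 ∧ η.HasFrobCharpolyAt v (Polynomial.X - Polynomial.C a)) ∧ ∀ᶠ v : IsDedekindDomain.HeightOneSpectrum (NumberField.RingOfIntegers K) in Filter.cofinite, ∃ (P : Polynomial (PadicAlgCl ℓ)) (a : PadicAlgCl ℓ), ρ.HasFrobCharpolyAt v P ∧ η.HasFrobCharpolyAt v (Polynomial.X - Polynomial.C a) ∧ P.scaleRoots a = P) → ((((¬ (∃ (L : Type) (_ : Field L) (_ : NumberField L) (_ : Algebra K L), IsGalois K L ∧ IsSolvable (L ≃ₐ[K] L) ∧ ∃ (K₀ : Type) (_ : Field K₀) (_ : NumberField K₀) (_ : Algebra K₀ L), IsGalois K₀ L ∧ IsSolvable (L ≃ₐ[K₀] L) ∧ ∃ (ρ₀ : Literature.NumberTheory.GaloisRepresentations.FramedGaloisRep K₀ (PadicAlgCl ℓ) n) (χ : Literature.NumberTheory.GaloisRepresentations.FramedGaloisRep L (PadicAlgCl ℓ) 1), ((∀ᶠ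 v : IsDedekindDomain.HeightOneSpectrum (NumberField.RingOfIntegers K₀) in Filter.cofinite, ρ₀.IsUnramifiedAt v) ∧ ∀ (v : IsDedekindDomain.HeightOneSpectrum (NumberField.RingOfIntegers K₀)) (hv : ((ℓ : ℕ) : NumberField.RingOfIntegers K₀) ∈ v.asIdeal), (Literature.NumberTheory.PAdicHodge.fontainePstAdicCompletion v ℓ hv).IsDeRhamFramed (ρ₀.toLocal v)) ∧ (NumberField.IsTotallyReal K₀ ∨ NumberField.IsCMField K₀) ∧ ∀ g : Field.absoluteGaloisGroup L, Literature.NumberTheory.GaloisRepresentations.FramedRep.trace (ρ.restrictField L) g = Literature.NumberTheory.GaloisRepresentations.FramedRep.trace χ g * Literature.NumberTheory.GaloisRepresentations.FramedRep.trace (ρ₀.restrictField L) g) ∧ (¬ (∃ (L : Type) (_ : Field L) (_ : NumberField L) (_ : Algebra K L), IsGalois K L ∧ IsSolvable (L ≃ₐ[K] L) ∧ ∃ (K₀ : Type) (_ : Field K₀) (_ : NumberField K₀) (_ : Algebra K₀ L), IsGalois K₀ L ∧ IsSolvable (L ≃ₐ[K₀] L) ∧ ∃ (ρ₀ : Literature.NumberTheory.GaloisRepresentations.FramedGaloisRep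 K₀ (PadicAlgCl ℓ) n) (χ : Literature.NumberTheory.GaloisRepresentations.FramedGaloisRep L (PadicAlgCl ℓ) 1), ((∀ᶠ v : IsDedekindDomain.HeightOneSpectrum (NumberField.RingOfIntegers K₀) in Filter.cofinite, ρ₀.IsUnramifiedAt v) ∧ ∀ (v : IsDedekindDomain.HeightOneSpectrum (NumberField.RingOfIntegers K₀)) (hv : ((ℓ : ℕ) : NumberField.RingOfIntegers K₀) ∈ v.asIdeal), (Literature.NumberTheory.PAdicHodge.fontainePstAdicCompletion v ℓ hv).IsDeRhamFramed (ρ₀.toLocal v)) ∧ (∃ (F₀ : Type) (_ : Field F₀) (_ : NumberField F₀) (_ : Algebra F₀ K₀) (_ : FiniteDimensional F₀ K₀) (hF : Module.finrank F₀ K₀ = 2), NumberField.IsTotallyReal F₀ ∧ (∃ (μ : Literature.NumberTheory.GaloisRepresentations.FramedGaloisRep F₀ (PadicAlgCl ℓ) 1) (A : Matrix (Fin (2 * n)) (Fin (2 * n)) (PadicAlgCl ℓ)), IsUnit A.det ∧ (∀ σ : Field.absoluteGaloisGroup F₀, ((ρ₀.induce F₀ hF) σ).val.transpose * A * ((ρ₀.induce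 F₀ hF) σ).val = Literature.NumberTheory.GaloisRepresentations.FramedRep.trace μ σ • A) ∧ ∀ (φ : F₀ →+* ℝ) (c : Field.absoluteGaloisGroup F₀), Literature.NumberTheory.GaloisRepresentations.IsComplexConjugation φ c → A.transpose = Literature.NumberTheory.GaloisRepresentations.FramedRep.trace μ c • A) ∧ (∀ (v : IsDedekindDomain.HeightOneSpectrum (NumberField.RingOfIntegers F₀)) (hv : ((ℓ : ℕ) : NumberField.RingOfIntegers F₀) ∈ v.asIdeal) (τ : v.adicCompletion F₀ →+* PadicAlgCl ℓ), Continuous τ → ((ρ₀.induce F₀ hF).labelledHodgeTateWeightsAt v (Literature.NumberTheory.PAdicHodge.fontainePstAdicCompletion v ℓ hv).algebra (Literature.NumberTheory.PAdicHodge.fontainePstAdicCompletion v ℓ hv).𝔅 τ).Nodup)) ∧ ∀ g : Field.absoluteGaloisGroup L, Literature.NumberTheory.GaloisRepresentations.FramedRep.trace (ρ.restrictField L) g = Literature.NumberTheory.GaloisRepresentations.FramedRep.trace χ g * Literature.NumberTheory.GaloisRepresentations.FramedRep.trace (ρ₀.restrictField L) g) ∧ ¬ (∃ (L : Type) (_ :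 Field L) (_ : NumberField L) (_ : Algebra K L), IsGalois K L ∧ IsSolvable (L ≃ₐ[K] L) ∧ ∃ (K₀ : Type) (_ : Field K₀) (_ : NumberField K₀) (_ : Algebra K₀ L), IsGalois K₀ L ∧ IsSolvable (L ≃ₐ[K₀] L) ∧ ∃ (ρ₀ : Literature.NumberTheory.GaloisRepresentations.FramedGaloisRep K₀ (PadicAlgCl ℓ) n) (χ : Literature.NumberTheory.GaloisRepresentations.FramedGaloisRep L (PadicAlgCl ℓ) 1), ((∀ᶠ v : IsDedekindDomain.HeightOneSpectrum (NumberField.RingOfIntegers K₀) in Filter.cofinite, ρ₀.IsUnramifiedAt v) ∧ ∀ (v : IsDedekindDomain.HeightOneSpectrum (NumberField.RingOfIntegers K₀)) (hv : ((ℓ : ℕ) : NumberField.RingOfIntegers K₀) ∈ v.asIdeal), (Literature.NumberTheory.PAdicHodge.fontainePstAdicCompletion v ℓ hv).IsDeRhamFramed (ρ₀.toLocal v)) ∧ (n = 2 ∧ (∃ (F₀ : Type) (_ : Field F₀) (_ : NumberField F₀) (_ : Algebra F₀ K₀) (_ : FiniteDimensional F₀ K₀) (hF : Module.finrank F₀ K₀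 = 2), NumberField.IsTotallyReal F₀ ∧ (∃ (μ : Literature.NumberTheory.GaloisRepresentations.FramedGaloisRep F₀ (PadicAlgCl ℓ) 1) (A : Matrix (Fin (2 * n)) (Fin (2 * n)) (PadicAlgCl ℓ)), IsUnit A.det ∧ (∀ σ : Field.absoluteGaloisGroup F₀, ((ρ₀.induce F₀ hF) σ).val.transpose * A * ((ρ₀.induce F₀ hF) σ).val = Literature.NumberTheory.GaloisRepresentations.FramedRep.trace μ σ • A) ∧ ∀ (φ : F₀ →+* ℝ) (c : Field.absoluteGaloisGroup F₀), Literature.NumberTheory.GaloisRepresentations.IsComplexConjugation φ c → A.transpose = Literature.NumberTheory.GaloisRepresentations.FramedRep.trace μ c • A)) ∧ ∀ (v : IsDedekindDomain.HeightOneSpectrum (NumberField.RingOfIntegers K₀)) (hv : ((ℓ : ℕ) : NumberField.RingOfIntegers K₀) ∈ v.asIdeal) (τ : v.adicCompletion K₀ →+* PadicAlgCl ℓ), Continuous τ → ρ₀.labelledHodgeTateWeightsAt v (Literature.NumberTheory.PAdicHodge.fontainePstAdicCompletion v ℓ hv).algebra (Literature.NumberTheory.PAdicHodge.fontainePstAdicCompletion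 v ℓ hv).𝔅 τ = {0, 1}) ∧ ∀ g : Field.absoluteGaloisGroup L, Literature.NumberTheory.GaloisRepresentations.FramedRep.trace (ρ.restrictField L) g = Literature.NumberTheory.GaloisRepresentations.FramedRep.trace χ g * Literature.NumberTheory.GaloisRepresentations.FramedRep.trace (ρ₀.restrictField L) g))) ∧ ¬ (∃ (L : Type) (_ : Field L) (_ : NumberField L) (_ : Algebra K L), ∀ σ : Field.absoluteGaloisGroup L, ∃ c : PadicAlgCl ℓ, ((ρ.restrictField L σ : GL (Fin n) (PadicAlgCl ℓ)) : Matrix (Fin n) (Fin n) (PadicAlgCl ℓ)) = c • (1 : Matrix (Fin n) (Fin n) (PadicAlgCl ℓ)))) ∧ ¬ (∃ (L : Type) (_ : Field L) (_ : NumberField L) (_ : Algebra K L) (K₀ : Type) (_ : Field K₀) (_ : NumberField K₀) (_ : Algebra K₀ L), IsGalois K₀ L ∧ IsSolvable (L ≃ₐ[K₀] L) ∧ ∃ (F₀ : Type) (_ : Field F₀) (_ : NumberField F₀) (_ : Algebra F₀ K₀), IsGalois F₀ K₀ ∧ IsSolvable (K₀ ≃ₐ[F₀] K₀) ∧ (NumberField.IsTotallyReal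 F₀ ∨ NumberField.IsCMField F₀))) ∧ (∃ (F₀ : Type) (_ : Field F₀) (_ : NumberField F₀) (_ : Algebra F₀ K) (_ : FiniteDimensional F₀ K) (d : ℕ) (hd : Module.finrank F₀ K = d), (NumberField.IsTotallyReal F₀ ∨ NumberField.IsCMField F₀) ∧ Summit.Langlands.Langlands.Theorems.PolarisationCarvingBoxes.IsHTRegular (ρ.induce F₀ hd))) → ∀ (F₀ : Type) [Field F₀] [NumberField F₀] [Algebra F₀ K] [FiniteDimensional F₀ K] (d : ℕ) (hd : Module.finrank F₀ K = d), (NumberField.IsTotallyReal F₀ ∨ NumberField.IsCMField F₀) → Summit.Langlands.Langlands.Theorems.PolarisationCarvingBoxes.IsHTRegular (ρ.induce F₀ hd) → ∀ (m : ℕ) (hcpt₀ : Literature.NumberTheory.Automorphic.isCompact_glFiniteIntegralLevel m F₀), 2 ≤ m → ∀ (σ : Literature.NumberTheory.GaloisRepresentations.FramedGaloisRep F₀ (PadicAlgCl ℓ) m), σ.toGaloisRep.IsIrreducible → Summit.Langlands.Langlands.Theorems.PolarisationCarvingBoxes.IsPinnedGeometric σ → ¬ Summit.Langlands.Langlands.Theorems.PolarisationCarvingBoxes.HasSelfTwist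 σ → Summit.Langlands.Langlands.Theorems.PolarisationCarvingBoxes.IsHTRegular σ → (∃ (k : ℕ) (ω : Literature.NumberTheory.GaloisRepresentations.FramedGaloisRep F₀ (PadicAlgCl ℓ) k), ∀ g : Field.absoluteGaloisGroup F₀, Literature.NumberTheory.GaloisRepresentations.FramedRep.trace (ρ.induce F₀ hd) g = Literature.NumberTheory.GaloisRepresentations.FramedRep.trace σ g + Literature.NumberTheory.GaloisRepresentations.FramedRep.trace ω g) → ∃ π₀ : Literature.NumberTheory.Automorphic.CuspidalAutomorphicRepData m F₀ hcpt₀, π₀.1.IsLAlgebraic ∧ ∀ᶠ w : IsDedekindDomain.HeightOneSpectrum (NumberField.RingOfIntegers F₀) in Filter.cofinite, SatakeFrobCompatibleAt ι π₀.1 σ w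

/-- crux (rank 2) · IFD — INSOLUBLE FIBRE DESCENT, the ISOLATED NAMED WALL of the cell (BARRIER `SolvableImageBarrier` technique class head-on ·
IDEA-NEEDED with one programme in print: non-solvable base change [Getz2012Nonsolvable; GetzHahn2024 §13.5 «the case of an arbitrary extension E/F
is open»]): transfer of weak automorphy from the regular twist-primitive summands σ of Ind_K^{F₀} ρ over the TR/CM field F₀ back to ρ over K along
the NON-NORMAL extension K/F₀ whose Galois closure is INSOLUBLE (¬REACH).  UNR's hypotheses VERBATIM ∧ DRI, then the avatar block as hypothesis,
then UNR's conclusion VERBATIM.  Strictly downstream of every Shimura / Taylor–Wiles input (those are consumed upstairs, in RIA's host cells). -/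
def InsolubleFibreDescent : Prop :=
  ∀ (K : Type) [Field K] [NumberField K] (n : ℕ) (hcpt : Literature.NumberTheory.Automorphic.isCompact_glFiniteIntegralLevel n K), 2 ≤ n → ∀ (ℓ : ℕ) [Fact ℓ.Prime] (ι : PadicAlgCl ℓ ≃+* ℂ) (ρ : Literature.NumberTheory.GaloisRepresentations.FramedGaloisRep K (PadicAlgCl ℓ) n), ρ.toGaloisRep.IsIrreducible → ((∀ᶠ v : IsDedekindDomain.HeightOneSpectrum (NumberField.RingOfIntegers K) in Filter.cofinite, ρ.IsUnramifiedAt v) ∧ ∀ (v : IsDedekindDomain.HeightOneSpectrum (NumberField.RingOfIntegers K)) (hv : ((ℓ : ℕ) : NumberField.RingOfIntegers K) ∈ v.asIdeal), (Literature.NumberTheory.PAdicHodge.fontainePstAdicCompletion v ℓ hv).IsDeRhamFramed (ρ.toLocal v)) → ¬ (∃ η : Literature.NumberTheory.GaloisRepresentations.FramedGaloisRep K (PadicAlgCl ℓ) 1, (∃ᶠ v : IsDedekindDomain.HeightOneSpectrum (NumberField.RingOfIntegers K) in Filter.cofinite, ∃ a : PadicAlgCl ℓ, a ≠ 1 ∧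 η.HasFrobCharpolyAt v (Polynomial.X - Polynomial.C a)) ∧ ∀ᶠ v : IsDedekindDomain.HeightOneSpectrum (NumberField.RingOfIntegers K) in Filter.cofinite, ∃ (P : Polynomial (PadicAlgCl ℓ)) (a : PadicAlgCl ℓ), ρ.HasFrobCharpolyAt v P ∧ η.HasFrobCharpolyAt v (Polynomial.X - Polynomial.C a) ∧ P.scaleRoots a = P) → ((((¬ (∃ (L : Type) (_ : Field L) (_ : NumberField L) (_ : Algebra K L), IsGalois K L ∧ IsSolvable (L ≃ₐ[K] L) ∧ ∃ (K₀ : Type) (_ : Field K₀) (_ : NumberField K₀) (_ : Algebra K₀ L), IsGalois K₀ L ∧ IsSolvable (L ≃ₐ[K₀] L) ∧ ∃ (ρ₀ : Literature.NumberTheory.GaloisRepresentations.FramedGaloisRep K₀ (PadicAlgCl ℓ) n) (χ : Literature.NumberTheory.GaloisRepresentations.FramedGaloisRep L (PadicAlgCl ℓ) 1), ((∀ᶠ v : IsDedekindDomain.HeightOneSpectrum (NumberField.RingOfIntegers K₀) in Filter.cofinite, ρ₀.IsUnramifiedAt v) ∧ ∀ (v : IsDedekindDomain.HeightOneSpectrum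 (NumberField.RingOfIntegers K₀)) (hv : ((ℓ : ℕ) : NumberField.RingOfIntegers K₀) ∈ v.asIdeal), (Literature.NumberTheory.PAdicHodge.fontainePstAdicCompletion v ℓ hv).IsDeRhamFramed (ρ₀.toLocal v)) ∧ (NumberField.IsTotallyReal K₀ ∨ NumberField.IsCMField K₀) ∧ ∀ g : Field.absoluteGaloisGroup L, Literature.NumberTheory.GaloisRepresentations.FramedRep.trace (ρ.restrictField L) g = Literature.NumberTheory.GaloisRepresentations.FramedRep.trace χ g * Literature.NumberTheory.GaloisRepresentations.FramedRep.trace (ρ₀.restrictField L) g) ∧ (¬ (∃ (L : Type) (_ : Field L) (_ : NumberField L) (_ : Algebra K L), IsGalois K L ∧ IsSolvable (L ≃ₐ[K] L) ∧ ∃ (K₀ : Type) (_ : Field K₀) (_ : NumberField K₀) (_ : Algebra K₀ L), IsGalois K₀ L ∧ IsSolvable (L ≃ₐ[K₀] L) ∧ ∃ (ρ₀ : Literature.NumberTheory.GaloisRepresentations.FramedGaloisRep K₀ (PadicAlgCl ℓ) n) (χ : Literature.NumberTheory.GaloisRepresentations.FramedGaloisRep L (PadicAlgCl ℓ) 1),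 ((∀ᶠ v : IsDedekindDomain.HeightOneSpectrum (NumberField.RingOfIntegers K₀) in Filter.cofinite, ρ₀.IsUnramifiedAt v) ∧ ∀ (v : IsDedekindDomain.HeightOneSpectrum (NumberField.RingOfIntegers K₀)) (hv : ((ℓ : ℕ) : NumberField.RingOfIntegers K₀) ∈ v.asIdeal), (Literature.NumberTheory.PAdicHodge.fontainePstAdicCompletion v ℓ hv).IsDeRhamFramed (ρ₀.toLocal v)) ∧ (∃ (F₀ : Type) (_ : Field F₀) (_ : NumberField F₀) (_ : Algebra F₀ K₀) (_ : FiniteDimensional F₀ K₀) (hF : Module.finrank F₀ K₀ = 2), NumberField.IsTotallyReal F₀ ∧ (∃ (μ : Literature.NumberTheory.GaloisRepresentations.FramedGaloisRep F₀ (PadicAlgCl ℓ) 1) (A : Matrix (Fin (2 * n)) (Fin (2 * n)) (PadicAlgCl ℓ)), IsUnit A.det ∧ (∀ σ : Field.absoluteGaloisGroup F₀, ((ρ₀.induce F₀ hF) σ).val.transpose * A * ((ρ₀.induce F₀ hF) σ).val = Literature.NumberTheory.GaloisRepresentations.FramedRep.trace μ σ • A) ∧ ∀ (φ : F₀ →+*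 ℝ) (c : Field.absoluteGaloisGroup F₀), Literature.NumberTheory.GaloisRepresentations.IsComplexConjugation φ c → A.transpose = Literature.NumberTheory.GaloisRepresentations.FramedRep.trace μ c • A) ∧ (∀ (v : IsDedekindDomain.HeightOneSpectrum (NumberField.RingOfIntegers F₀)) (hv : ((ℓ : ℕ) : NumberField.RingOfIntegers F₀) ∈ v.asIdeal) (τ : v.adicCompletion F₀ →+* PadicAlgCl ℓ), Continuous τ → ((ρ₀.induce F₀ hF).labelledHodgeTateWeightsAt v (Literature.NumberTheory.PAdicHodge.fontainePstAdicCompletion v ℓ hv).algebra (Literature.NumberTheory.PAdicHodge.fontainePstAdicCompletion v ℓ hv).𝔅 τ).Nodup)) ∧ ∀ g : Field.absoluteGaloisGroup L, Literature.NumberTheory.GaloisRepresentations.FramedRep.trace (ρ.restrictField L) g = Literature.NumberTheory.GaloisRepresentations.FramedRep.trace χ g * Literature.NumberTheory.GaloisRepresentations.FramedRep.trace (ρ₀.restrictField L) g) ∧ ¬ (∃ (L : Type) (_ : Field L) (_ : NumberField L) (_ : Algebra K L), IsGalois K L ∧ IsSolvable (L ≃ₐ[K] L) ∧ ∃ (K₀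 : Type) (_ : Field K₀) (_ : NumberField K₀) (_ : Algebra K₀ L), IsGalois K₀ L ∧ IsSolvable (L ≃ₐ[K₀] L) ∧ ∃ (ρ₀ : Literature.NumberTheory.GaloisRepresentations.FramedGaloisRep K₀ (PadicAlgCl ℓ) n) (χ : Literature.NumberTheory.GaloisRepresentations.FramedGaloisRep L (PadicAlgCl ℓ) 1), ((∀ᶠ v : IsDedekindDomain.HeightOneSpectrum (NumberField.RingOfIntegers K₀) in Filter.cofinite, ρ₀.IsUnramifiedAt v) ∧ ∀ (v : IsDedekindDomain.HeightOneSpectrum (NumberField.RingOfIntegers K₀)) (hv : ((ℓ : ℕ) : NumberField.RingOfIntegers K₀) ∈ v.asIdeal), (Literature.NumberTheory.PAdicHodge.fontainePstAdicCompletion v ℓ hv).IsDeRhamFramed (ρ₀.toLocal v)) ∧ (n = 2 ∧ (∃ (F₀ : Type) (_ : Field F₀) (_ : NumberField F₀) (_ : Algebra F₀ K₀) (_ : FiniteDimensional F₀ K₀) (hF : Module.finrank F₀ K₀ = 2), NumberField.IsTotallyReal F₀ ∧ (∃ (μ : Literature.NumberTheory.GaloisRepresentations.FramedGaloisRep F₀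 (PadicAlgCl ℓ) 1) (A : Matrix (Fin (2 * n)) (Fin (2 * n)) (PadicAlgCl ℓ)), IsUnit A.det ∧ (∀ σ : Field.absoluteGaloisGroup F₀, ((ρ₀.induce F₀ hF) σ).val.transpose * A * ((ρ₀.induce F₀ hF) σ).val = Literature.NumberTheory.GaloisRepresentations.FramedRep.trace μ σ • A) ∧ ∀ (φ : F₀ →+* ℝ) (c : Field.absoluteGaloisGroup F₀), Literature.NumberTheory.GaloisRepresentations.IsComplexConjugation φ c → A.transpose = Literature.NumberTheory.GaloisRepresentations.FramedRep.trace μ c • A)) ∧ ∀ (v : IsDedekindDomain.HeightOneSpectrum (NumberField.RingOfIntegers K₀)) (hv : ((ℓ : ℕ) : NumberField.RingOfIntegers K₀) ∈ v.asIdeal) (τ : v.adicCompletion K₀ →+* PadicAlgCl ℓ), Continuous τ → ρ₀.labelledHodgeTateWeightsAt v (Literature.NumberTheory.PAdicHodge.fontainePstAdicCompletion v ℓ hv).algebra (Literature.NumberTheory.PAdicHodge.fontainePstAdicCompletion v ℓ hv).𝔅 τ = {0, 1}) ∧ ∀ g : Field.absoluteGaloisGroup L, Literature.NumberTheory.GaloisRepresentations.FramedRep.trace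 (ρ.restrictField L) g = Literature.NumberTheory.GaloisRepresentations.FramedRep.trace χ g * Literature.NumberTheory.GaloisRepresentations.FramedRep.trace (ρ₀.restrictField L) g))) ∧ ¬ (∃ (L : Type) (_ : Field L) (_ : NumberField L) (_ : Algebra K L), ∀ σ : Field.absoluteGaloisGroup L, ∃ c : PadicAlgCl ℓ, ((ρ.restrictField L σ : GL (Fin n) (PadicAlgCl ℓ)) : Matrix (Fin n) (Fin n) (PadicAlgCl ℓ)) = c • (1 : Matrix (Fin n) (Fin n) (PadicAlgCl ℓ)))) ∧ ¬ (∃ (L : Type) (_ : Field L) (_ : NumberField L) (_ : Algebra K L) (K₀ : Type) (_ : Field K₀) (_ : NumberField K₀) (_ : Algebra K₀ L), IsGalois K₀ L ∧ IsSolvable (L ≃ₐ[K₀] L) ∧ ∃ (F₀ : Type) (_ : Field F₀) (_ : NumberField F₀) (_ : Algebra F₀ K₀), IsGalois F₀ K₀ ∧ IsSolvable (K₀ ≃ₐ[F₀] K₀) ∧ (NumberField.IsTotallyReal F₀ ∨ NumberField.IsCMField F₀))) ∧ (∃ (F₀ : Type) (_ : Field F₀) (_ : NumberField F₀) (_ :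 Algebra F₀ K) (_ : FiniteDimensional F₀ K) (d : ℕ) (hd : Module.finrank F₀ K = d), (NumberField.IsTotallyReal F₀ ∨ NumberField.IsCMField F₀) ∧ Summit.Langlands.Langlands.Theorems.PolarisationCarvingBoxes.IsHTRegular (ρ.induce F₀ hd))) → (∀ (F₀ : Type) [Field F₀] [NumberField F₀] [Algebra F₀ K] [FiniteDimensional F₀ K] (d : ℕ) (hd : Module.finrank F₀ K = d), (NumberField.IsTotallyReal F₀ ∨ NumberField.IsCMField F₀) → Summit.Langlands.Langlands.Theorems.PolarisationCarvingBoxes.IsHTRegular (ρ.induce F₀ hd) → ∀ (m : ℕ) (hcpt₀ : Literature.NumberTheory.Automorphic.isCompact_glFiniteIntegralLevel m F₀), 2 ≤ m → ∀ (σ : Literature.NumberTheory.GaloisRepresentations.FramedGaloisRep F₀ (PadicAlgCl ℓ) m), σ.toGaloisRep.IsIrreducible → Summit.Langlands.Langlands.Theorems.PolarisationCarvingBoxes.IsPinnedGeometric σ → ¬ Summit.Langlands.Langlands.Theorems.PolarisationCarvingBoxes.HasSelfTwist σ → Summit.Langlands.Langlands.Theorems.PolarisationCarvingBoxes.IsHTRegular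 σ → (∃ (k : ℕ) (ω : Literature.NumberTheory.GaloisRepresentations.FramedGaloisRep F₀ (PadicAlgCl ℓ) k), ∀ g : Field.absoluteGaloisGroup F₀, Literature.NumberTheory.GaloisRepresentations.FramedRep.trace (ρ.induce F₀ hd) g = Literature.NumberTheory.GaloisRepresentations.FramedRep.trace σ g + Literature.NumberTheory.GaloisRepresentations.FramedRep.trace ω g) → ∃ π₀ : Literature.NumberTheory.Automorphic.CuspidalAutomorphicRepData m F₀ hcpt₀, π₀.1.IsLAlgebraic ∧ ∀ᶠ w : IsDedekindDomain.HeightOneSpectrum (NumberField.RingOfIntegers F₀) in Filter.cofinite, SatakeFrobCompatibleAt ι π₀.1 σ w) → ∃ π : Literature.NumberTheory.Automorphic.CuspidalAutomorphicRepData n K hcpt, π.1.IsLAlgebraic ∧ ∀ᶠ v : IsDedekindDomain.HeightOneSpectrum (NumberField.RingOfIntegers K) in Filter.cofinite, SatakeFrobCompatibleAt ι π.1 ρ v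

/-- support (rank 9) · FRAME″ — the host route below UNR as one implication BY NAME. -/
def UnreachableFrame : Prop :=
  Summit.Langlands.Langlands.Theses.AnchoredInductionCarving.UnreachableDeepAutomorphy → _root_.Langlands

/-- assembly (rank 1) · the curried `closes`. -/
def Assembly : Prop :=
  RegularInsolubleAvatarAutomorphy → InsolubleFibreDescent → NonInducedUnreachableAutomorphy → UnreachableFrame → _root_.Langlands

/-! ## §4  Bridges: every inline text IS the structured statement (`Iff.rfl`) -/

/-- NIU inline text ≡ structured form `UNR-box ∧ ¬ DRI`. -/
theorem niu_iff_box :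
    NonInducedUnreachableAutomorphy ↔
      PrimitiveAutomorphyWhere fun K _ _ ℓ _ n ρ =>
        UnrBox (K := K) (ℓ := ℓ) (n := n) ρ ∧ ¬ InducesRegularlyToSubfield (K := K) (ℓ := ℓ) (n := n) ρ :=
  Iff.rfl

/-- DIU inline text ≡ structured form `UNR-box ∧ DRI`. -/
theorem diu_iff_box :
    DirectlyInducedUnreachableAutomorphy ↔
      PrimitiveAutomorphyWhere fun K _ _ ℓ _ n ρ =>
        UnrBox (K := K) (ℓ := ℓ) (n := n) ρ ∧ InducesRegularlyToSubfield (K := K) (ℓ := ℓ) (n := n) ρ :=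
  Iff.rfl

/-- RIA inline text ≡ structured form (avatar automorphy over every TR/CM subfield with regular induction). -/
theorem ria_iff :
    RegularInsolubleAvatarAutomorphy ↔
      PrimitiveWhere
        (fun K _ _ ℓ _ n ρ => UnrBox (K := K) (ℓ := ℓ) (n := n) ρ ∧ InducesRegularlyToSubfield (K := K) (ℓ := ℓ) (n := n) ρ)
        (fun K _ _ ℓ _ n ι _ ρ => AvatarAutomorphy (K := K) (ℓ := ℓ) ι (n := n) ρ) :=
  Iff.rfl

/-- IFD inline text ≡ structured form (RIA-shaped avatar automorphy ⇒ automorphy of ρ over K on the DIU box). -/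
theorem ifd_iff :
    InsolubleFibreDescent ↔
      PrimitiveWhere
        (fun K _ _ ℓ _ n ρ => UnrBox (K := K) (ℓ := ℓ) (n := n) ρ ∧ InducesRegularlyToSubfield (K := K) (ℓ := ℓ) (n := n) ρ)
        (fun K _ _ ℓ _ n ι hcpt ρ => AvatarAutomorphy (K := K) (ℓ := ℓ) ι (n := n) ρ → WeaklyAutomorphic (F := K) (ℓ := ℓ) ι (m := n) hcpt ρ) :=
  Iff.rfl

/-- FRAME″ ≡ `UNR → Langlands`. -/
theorem frame_iff : UnreachableFrame ↔ (AnchoredInductionCarving.UnreachableDeepAutomorphy → _root_.Langlands) := Iff.rfl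

/-- Assembly ≡ the implication chain RIA → IFD → NIU → FRAME″ → Langlands. -/
theorem assembly_iff :
    Assembly ↔ (RegularInsolubleAvatarAutomorphy → InsolubleFibreDescent → NonInducedUnreachableAutomorphy → UnreachableFrame →
      _root_.Langlands) :=
  Iff.rfl

/-! ## §5  Logic of the cut -/

/-- UNR ⟹ DIU (sub-box). -/
theorem diu_of_unr (h : AnchoredInductionCarving.UnreachableDeepAutomorphy) : DirectlyInducedUnreachableAutomorphy := by
  intro K _ _ n hcpt hn ℓ _ ι ρ hirr hgeo htw hbox
  exact h K n hcpt hn ℓ ι ρ hirr hgeo htw hbox.1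

/-- UNR ⟹ NIU (sub-box). -/
theorem niu_of_unr (h : AnchoredInductionCarving.UnreachableDeepAutomorphy) : NonInducedUnreachableAutomorphy := by
  intro K _ _ n hcpt hn ℓ _ ι ρ hirr hgeo htw hbox
  exact h K n hcpt hn ℓ ι ρ hirr hgeo htw hbox.1

/-- UNR ⟹ IFD (IFD's conclusion is UNR's on a sub-box; the avatar hypothesis is not needed). -/
theorem ifd_of_unr (h : AnchoredInductionCarving.UnreachableDeepAutomorphy) : InsolubleFibreDescent := by
  intro K _ _ n hcpt hn ℓ _ ι ρ hirr hgeo htw hbox _hav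
  exact h K n hcpt hn ℓ ι ρ hirr hgeo htw hbox.1

/-- **DIU → NIU → UNR** (one excluded middle on the dial DRI). -/
theorem unr_of_cells (hD : DirectlyInducedUnreachableAutomorphy) (hN : NonInducedUnreachableAutomorphy) :
    AnchoredInductionCarving.UnreachableDeepAutomorphy := by
  intro K _ _ n hcpt hn ℓ _ ι ρ hirr hgeo htw hbox
  by_cases hI : InducesRegularlyToSubfield ρ
  · exact hD K n hcpt hn ℓ ι ρ hirr hgeo htw ⟨hbox, hI⟩
  · exact hN K n hcpt hn ℓ ι ρ hirr hgeo htw ⟨hbox, hI⟩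

/-- **UNR ⟺ DIU ∧ NIU** — the cell split of the target is exact (0 EQUIV introduced). -/
theorem unr_iff_cells :
    AnchoredInductionCarving.UnreachableDeepAutomorphy ↔ (DirectlyInducedUnreachableAutomorphy ∧ NonInducedUnreachableAutomorphy) :=
  ⟨fun h => ⟨diu_of_unr h, niu_of_unr h⟩, fun h => unr_of_cells h.1 h.2⟩

/-- The two cell predicates partition UNR's box for a single ρ (cover by excluded middle, disjoint by their typed conjuncts). -/
theorem cell_predicates_partition {K : Type} [Field K] [NumberField K] {ℓ : ℕ} [Fact ℓ.Prime] {n : ℕ}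
    (ρ : FramedGaloisRep K (PadicAlgCl ℓ) n) (B : Prop) :
    (B ↔ ((B ∧ InducesRegularlyToSubfield ρ) ∨ (B ∧ ¬ InducesRegularlyToSubfield ρ))) ∧
      ¬ ((B ∧ InducesRegularlyToSubfield ρ) ∧ (B ∧ ¬ InducesRegularlyToSubfield ρ)) :=
  ⟨⟨fun h => (Classical.em _).imp (fun hI => ⟨h, hI⟩) (fun hI => ⟨h, hI⟩), fun h => h.elim And.left And.left⟩, fun h => h.2.2 h.1.2⟩

/-- **DIU ⟸ RIA ∧ IFD** (the functional split of the attacked cell: modus ponens pointwise in (K, ρ)). -/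
theorem diu_of_ria_ifd (hR : RegularInsolubleAvatarAutomorphy) (hI : InsolubleFibreDescent) : DirectlyInducedUnreachableAutomorphy := by
  intro K _ _ n hcpt hn ℓ _ ι ρ hirr hgeo htw hbox
  exact hI K n hcpt hn ℓ ι ρ hirr hgeo htw hbox (hR K n hcpt hn ℓ ι ρ hirr hgeo htw hbox)

/-- **FRAME″ from the host**: the host route's deciding TREE theorem `AnchoredInductionCarving.closes` with UNR abstracted; RID, RCH and the
host's own FRAME′ (= SolvableMonodromyCarving below DII) taken as host decls BY NAME. -/
theorem frame_of_host (hRID : AnchoredInductionCarving.RegularlyInducedDeepAutomorphy)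
    (hRCH : AnchoredInductionCarving.ReachableIrregularDeepAutomorphy) (hF : AnchoredInductionCarving.DeepInfiniteImageFrame) :
    UnreachableFrame :=
  fun hUNR => AnchoredInductionCarving.closes hRID hRCH hUNR hF

/-- **`closes` (the child route's deciding theorem)**: RIA → IFD → NIU → FRAME″ → `Langlands`. -/
theorem closes (hRIA : RegularInsolubleAvatarAutomorphy) (hIFD : InsolubleFibreDescent) (hNIU : NonInducedUnreachableAutomorphy)
    (hF : UnreachableFrame) : _root_.Langlands :=
  hF (unr_of_cells (diu_of_ria_ifd hRIA hIFD) hNIU)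

/-- **`closes_glue`** = the child route's `childroute.glue.lean` VERBATIM (self-contained: one `Classical.byCases` on the inlined dial, whose text
is INFERRED from the cells' hypotheses — never restated; modus ponens RIA ⇒ IFD ⇒ cell, then through the frame). -/
theorem closes_glue (hRIA : RegularInsolubleAvatarAutomorphy) (hIFD : InsolubleFibreDescent) (hNIU : NonInducedUnreachableAutomorphy)
    (hF : UnreachableFrame) : _root_.Langlands := by
  refine hF ?_
  intro K _ _ n hcpt hn ℓ _ ι ρ hirr hgeo htw hbox
  refine Classical.byCases
    (fun hI => hIFD K n hcpt hn ℓ ι ρ hirr hgeo htw ⟨hbox, hI⟩ (hRIA K n hcpt hn ℓ ι ρ hirr hgeo htw ⟨hbox, hI⟩))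
    (fun hI => hNIU K n hcpt hn ℓ ι ρ hirr hgeo htw ⟨hbox, hI⟩)

/-- `Assembly` is the curried `closes`. -/
theorem assembly_holds : Assembly := closes

/-- The full certificate through the host TREE route (no FRAME″ abbreviation): RIA → IFD → NIU → RID → RCH → host FRAME′ → `Langlands`. -/
theorem closes_expanded (hRIA : RegularInsolubleAvatarAutomorphy) (hIFD : InsolubleFibreDescent) (hNIU : NonInducedUnreachableAutomorphy)
    (hRID : AnchoredInductionCarving.RegularlyInducedDeepAutomorphy) (hRCH : AnchoredInductionCarving.ReachableIrregularDeepAutomorphy)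
    (hF : AnchoredInductionCarving.DeepInfiniteImageFrame) : _root_.Langlands :=
  closes hRIA hIFD hNIU (frame_of_host hRID hRCH hF)

/-! ## §6  Certificates -/

/-! ## §3c  Identity with the born route's items (`Iff.rfl` ×5: same texts, route decls BY NAME) -/

/-- NIU (route item stmt-Langlands-28044) ≡ this module's `NonInducedUnreachableAutomorphy`. -/
theorem niu_iff_route : NonInducedUnreachableAutomorphy ↔ InsolubleInductionCarving.NonInducedUnreachableAutomorphy := Iff.rfl
/-- RIA (route item stmt-Langlands-28045) ≡ this module's `RegularInsolubleAvatarAutomorphy`. -/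
theorem ria_iff_route : RegularInsolubleAvatarAutomorphy ↔ InsolubleInductionCarving.RegularInsolubleAvatarAutomorphy := Iff.rfl
/-- IFD (route item stmt-Langlands-28043) ≡ this module's `InsolubleFibreDescent`. -/
theorem ifd_iff_route : InsolubleFibreDescent ↔ InsolubleInductionCarving.InsolubleFibreDescent := Iff.rfl
/-- FRAME″ (route item stmt-Langlands-28046) ≡ this module's `UnreachableFrame`. -/
theorem frame_iff_route : UnreachableFrame ↔ InsolubleInductionCarving.UnreachableFrame := Iff.rfl
/-- Assembly (route item stmt-Langlands-28047) ≡ this module's `Assembly`. -/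
theorem assembly_iff_route : Assembly ↔ InsolubleInductionCarving.Assembly := Iff.rfl
/-- the born route's `closes` and this module's `closes` have the same shape: the route closes from this module's cells. -/
theorem route_closes_of_cells (hRIA : RegularInsolubleAvatarAutomorphy) (hIFD : InsolubleFibreDescent) (hNIU : NonInducedUnreachableAutomorphy)
    (hF : UnreachableFrame) : _root_.Langlands :=
  InsolubleInductionCarving.closes (ria_iff_route.1 hRIA) (ifd_iff_route.1 hIFD) (niu_iff_route.1 hNIU) (frame_iff_route.1 hF)

end Summit.Langlands.Langlands.Theorems.InsolubleInduction
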